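import Mathlib
import Summits.Ventures.PercRepro2.Defs
import Summits.Ventures.PercRepro2.Graph
import Summits.Ventures.PercRepro2.OneColourSwitch
import Summits.Ventures.PercRepro2.RegionHubSign
import Summits.Ventures.PercRepro2.SideSwitch
import Summits.Ventures.PercRepro2.TermSwitchDefs
import Summits.Ventures.PercRepro2.M9NoPocketDefs
import Summits.Ventures.PercRepro2.M9ReachedSum
import Summits.Ventures.PercRepro2.M9KOnlyStar

/-!
# REACH-star is a theorem (blind cell PercRepro2, p3 g33, 2026-08-28; `proofs/P3-BSTAR.md` §3)

The conjecture REACH-star of `proofs/P3-HDR.md` §7(b): for every colouring `c` of the edges at a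
non-mark `d`, the one-sided reached colourings of the `d`-star co-fibre `c` have non-positive
sum, `Σ_{Sep ∧ DOne ∧ d in exactly one world, ω|star = c} σ_pq σ_rs ≤ 0`.  It is the sum of the
two one-sided parts of the co-fibre (`reachStarSum_eq_kOnly_add_mOnly`), each non-positive by
`M9KOnlyStar` (`kOnlyStarSum_nonpos`, `mOnlyStarSum_nonpos`): **`reachStarSum_nonpos`**
(`T`-edges allowed).  Summed over the stars it is REACH (`reachedOneSum_nonpos`, M9ReachedSum);
the doubly-reached part `EX` of a co-fibre is NOT sign-definite (the record's co-fibre witnesses),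
so this is the sharp per-co-fibre statement.  Own work; std axioms.
-/

namespace Summit.Ventures.PercRepro2

namespace NoPocket

open Finset Classical RegionHub OneColourSwitch SideSwitch TermSwitch

variable {V : Type*} {E : Type*}

section ReachStar

variable [Fintype V] [DecidableEq V] [Fintype E] [DecidableEq E] {ends : E → Sym2 V}
  {p q r s d : V}

/-- The one-sided reached sum of the `d`-star co-fibre `c` (REACH-star's left-hand side). -/
noncomputable def reachStarSum (ends : E → Sym2 V) (p q r s d : V) (c : E → Bool) : ℤ :=
  ∑ ω : Config E, if sep2 ends p q r s ω ∧ DOne ends r s d ω ∧ OneSided ends r s d ω ∧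
      StarEq ends d c ω then sigma ends ω p q * sigma ends ω r s else 0

omit [Fintype V] [DecidableEq V] [Fintype E] [DecidableEq E] in
/-- Pointwise: the one-sided term with the star `c` is the `K`-only term plus the `M`-only term. -/
lemma oneSided_star_term_split (c : E → Bool) (ω : Config E) :
    (if sep2 ends p q r s ω ∧ DOne ends r s d ω ∧ OneSided ends r s d ω ∧ StarEq ends d c ω
        then sigma ends ω p q * sigma ends ω r s else 0) =
      (if sep2 ends p q r s ω ∧ DOne ends r s d ω ∧
          (d ∈ K2 ends r s ω ∧ d ∉ M2 ends r s ω) ∧ StarEq ends d c ω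
        then sigma ends ω p q * sigma ends ω r s else 0) +
      (if sep2 ends p q r s ω ∧ DOne ends r s d ω ∧
          (d ∈ M2 ends r s ω ∧ d ∉ K2 ends r s ω) ∧ StarEq ends d c ω
        then sigma ends ω p q * sigma ends ω r s else 0) := by
  by_cases h0 : sep2 ends p q r s ω ∧ DOne ends r s d ω ∧ StarEq ends d c ω
  · by_cases hK : d ∈ K2 ends r s ω
    · by_cases hM : d ∈ M2 ends r s ω
      · rw [if_neg (fun h => h.2.2.1.2 ⟨hK, hM⟩), if_neg (fun h => h.2.2.1.2 hM),
          if_neg (fun h => h.2.2.1.2 hK), add_zero]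
      · rw [if_pos ⟨h0.1, h0.2.1, ⟨Or.inl hK, fun h => hM h.2⟩, h0.2.2⟩,
          if_pos ⟨h0.1, h0.2.1, ⟨hK, hM⟩, h0.2.2⟩, if_neg (fun h => hM h.2.2.1.1), add_zero]
    · by_cases hM : d ∈ M2 ends r s ω
      · rw [if_pos ⟨h0.1, h0.2.1, ⟨Or.inr hM, fun h => hK h.1⟩, h0.2.2⟩,
          if_neg (fun h => hK h.2.2.1.1), if_pos ⟨h0.1, h0.2.1, ⟨hM, hK⟩, h0.2.2⟩, zero_add]
      · rw [if_neg (fun h => h.2.2.1.1.elim hK hM), if_neg (fun h => hK h.2.2.1.1),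
          if_neg (fun h => hM h.2.2.1.1), add_zero]
  · rw [if_neg (fun h => h0 ⟨h.1, h.2.1, h.2.2.2⟩), if_neg (fun h => h0 ⟨h.1, h.2.1, h.2.2.2⟩),
      if_neg (fun h => h0 ⟨h.1, h.2.1, h.2.2.2⟩), add_zero]

omit [Fintype V] [DecidableEq V] in
/-- **REACH-star's sum is the `K`-only part plus the `M`-only part of the co-fibre.** -/
theorem reachStarSum_eq_kOnly_add_mOnly (c : E → Bool) :
    reachStarSum ends p q r s d c =
      kOnlyStarSum ends p q r s d c + mOnlyStarSum ends p q r s d c := by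
  unfold reachStarSum kOnlyStarSum mOnlyStarSum
  rw [← Finset.sum_add_distrib]
  exact Finset.sum_congr rfl fun ω _ => oneSided_star_term_split c ω

/-- **REACH-star** (`proofs/P3-HDR.md` §7(b)): for every non-mark `d ≠ r, s` and every colouring
`c` of the edges at `d`, `Σ_{Sep ∧ DOne ∧ d in exactly one world, ω|star = c} σ_pq σ_rs ≤ 0`. -/
theorem reachStarSum_nonpos (hr : d ≠ r) (hs : d ≠ s) (c : E → Bool) :
    reachStarSum ends p q r s d c ≤ 0 := by
  rw [reachStarSum_eq_kOnly_add_mOnly]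
  have h1 := kOnlyStarSum_nonpos (ends := ends) (p := p) (q := q) hr hs c
  have h2 := mOnlyStarSum_nonpos (ends := ends) (p := p) (q := q) hr hs c
  linarith

end ReachStar

end NoPocket

end Summit.Ventures.PercRepro2
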